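import Summits.QuantumAdvantage.AdviceFreeQNC0.WindowLocalization
import HarnessLib

/-!
# Cell qa-qnc0 (rung F-Q1, route RingFrame, crux α `RingToElim`): TWO BLIND SPOTS — bit flips
# outside a window move the fibre and shift its charge

Tools for the two-blind-spots theorem (THEOREM-TARGET T8 of planner qa-qnc0-p1, `Sketch11`
§23.1; main file `TwoBlindSpots.lean`):

* `card_filter_flip` — flipping one bit is a bijection of the cube (counts are preserved);
* `wt_update_add` — the weight after an update;
* `glue3_apply_lt/mid/ge` — reading the three blocks of `a ++ w ++ b`;
* `exists_flip_glue3` — for a position `i` OUTSIDE the window `[p, p+M)`, flipping bit `i` of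
  `a ++ w ++ b` gives `a' ++ w ++ b'` with outside blocks `(a', b')` independent of `w`, and the
  window charge `c' = c + p + 2|a| + |b|` (`inCharge`) moves to `c' + s` with `s ≡ 1` or `2`
  (mod 3) — `s` depends only on the side of `i` and the flipped bit.

The cell's lemmas (prover qn-prover-3 gen 4, 2026-08-27); folklore bookkeeping, not in print.
WHAT THIS IS NOT: nothing on α by itself; no separation.
-/

noncomputable section

namespace Summit.QuantumAdvantage.AdviceFreeQNC0

open Finset
open Literature.Computability.MetaComplexity Literature.Computability.MetaComplexity.Smolensky

/-! ### Small tools -/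

/-- Flipping a bit twice is the identity. -/
theorem update_not_update_not {n : ℕ} (i : Fin n) (u : Fin n → Bool) :
    Function.update (Function.update u i (!u i)) i (!(Function.update u i (!u i)) i) = u := by
  funext k
  by_cases hk : k = i
  · subst hk; simp
  · simp [Function.update_of_ne hk]

/-- **A bit flip is a bijection of the cube**: counting a property after flipping bit `i` counts
the property. -/
theorem card_filter_flip {n : ℕ} (i : Fin n) (P : (Fin n → Bool) → Prop) [DecidablePred P] :
    (univ.filter fun u : Fin n → Bool => P (Function.update u i (!u i))).card =
      (univ.filter fun u : Fin n → Bool => P u).card := by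
  refine Finset.card_bij (fun u _ => Function.update u i (!u i)) (fun u hu => ?_)
    (fun u₁ _ u₂ _ h => ?_) (fun u hu => ?_)
  · rw [Finset.mem_filter] at hu ⊢
    exact ⟨Finset.mem_univ _, hu.2⟩
  · have h' := congrArg (fun v : Fin n → Bool => Function.update v i (!v i)) h
    simpa only [update_not_update_not] using h'
  · refine ⟨Function.update u i (!u i), ?_, update_not_update_not i u⟩
    rw [Finset.mem_filter] at hu ⊢
    refine ⟨Finset.mem_univ _, ?_⟩
    rw [update_not_update_not]
    exact hu.2

/-- Weight after an update: `|update a i v| + [a i] = |a| + [v]`. -/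
theorem wt_update_add {k : ℕ} (a : Fin k → Bool) (i : Fin k) (v : Bool) :
    wt (Function.update a i v) + (if a i = true then 1 else 0) = wt a + (if v = true then 1 else 0) := by
  classical
  unfold wt
  rw [Finset.card_filter, Finset.card_filter]
  rw [← Finset.add_sum_erase _ _ (Finset.mem_univ i), ← Finset.add_sum_erase _ _ (Finset.mem_univ i)]
  have hrest : ∑ x ∈ univ.erase i, (if Function.update a i v x = true then 1 else 0) =
      ∑ x ∈ univ.erase i, (if a x = true then 1 else 0) :=
    Finset.sum_congr rfl fun x hx => by rw [Function.update_of_ne (Finset.ne_of_mem_erase hx)]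
  rw [hrest, Function.update_self]
  ring

/-! ### Reading the three blocks of a glued input -/

variable {p M q : ℕ}

/-- A position of the prefix block reads `a`. -/
theorem glue3_apply_lt (a : Fin p → Bool) (w : Fin M → Bool) (b : Fin q → Bool)
    (k : Fin (p + M + q)) (hk : k.val < p) : glue3 a w b k = a ⟨k.val, hk⟩ := by
  have e : k = Fin.castAdd q (Fin.castAdd M ⟨k.val, hk⟩) := Fin.ext (by simp)
  rw [congrArg (glue3 a w b) e]
  unfold glue3
  rw [Fin.append_left, Fin.append_left]

/-- A position of the window reads `w`. -/
theorem glue3_apply_mid (a : Fin p → Bool) (w : Fin M → Bool) (b : Fin q → Bool)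
    (k : Fin (p + M + q)) (h1 : p ≤ k.val) (h2 : k.val < p + M) :
    glue3 a w b k = w ⟨k.val - p, by omega⟩ := by
  have e : k = Fin.castAdd q (Fin.natAdd p ⟨k.val - p, by omega⟩) := Fin.ext (by simp; omega)
  rw [congrArg (glue3 a w b) e]
  unfold glue3
  rw [Fin.append_left, Fin.append_right]

/-- A position of the suffix block reads `b`. -/
theorem glue3_apply_ge (a : Fin p → Bool) (w : Fin M → Bool) (b : Fin q → Bool)
    (k : Fin (p + M + q)) (hk : p + M ≤ k.val) :
    glue3 a w b k = b ⟨k.val - (p + M), by omega⟩ := by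
  have e : k = Fin.natAdd (p + M) ⟨k.val - (p + M), by omega⟩ := Fin.ext (by simp; omega)
  rw [congrArg (glue3 a w b) e]
  unfold glue3
  rw [Fin.append_right]

/-- **Flipping an outside bit moves the fibre**: for a position `i` outside the window, flipping
bit `i` of `a ++ w ++ b` gives `a' ++ w ++ b'` for outside blocks `(a', b')` not depending on `w`,
whose window charge is `c' + s` with `s ≡ 1` or `2` (mod 3) determined by the side of `i` and
the flipped bit: `s = 1` (left, bit `1`), `2` (left, bit `0`), `2` (right, bit `1`), `1`
(right, bit `0`). -/
theorem exists_flip_glue3 (c : ℕ) (i : Fin (p + M + q)) (hi : ¬ (p ≤ i.val ∧ i.val < p + M))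
    (a : Fin p → Bool) (b : Fin q → Bool) :
    ∃ (a' : Fin p → Bool) (b' : Fin q → Bool),
      (∀ w : Fin M → Bool,
        Function.update (glue3 a w b) i (!(glue3 a w b i)) = glue3 a' w b') ∧
      ∀ w : Fin M → Bool, inCharge c a' b' % 3 =
        (inCharge c a b + (if i.val < p then (if glue3 a w b i = true then 1 else 2)
          else (if glue3 a w b i = true then 2 else 1))) % 3 := by
  by_cases hip : i.val < p
  · -- `i` in the prefix block
    refine ⟨Function.update a ⟨i.val, hip⟩ (!a ⟨i.val, hip⟩), b, fun w => ?_, fun w => ?_⟩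
    · funext k
      by_cases hk : k = i
      · subst hk
        rw [Function.update_self, glue3_apply_lt a w b k hip,
          glue3_apply_lt (Function.update a ⟨k.val, hip⟩ (!a ⟨k.val, hip⟩)) w b k hip,
          Function.update_self]
      · rw [Function.update_of_ne hk]
        by_cases hkp : k.val < p
        · rw [glue3_apply_lt a w b k hkp, glue3_apply_lt _ w b k hkp, Function.update_of_ne]
          intro h
          apply hk
          exact Fin.ext (by simpa using congrArg Fin.val h)
        · by_cases hkm : k.val < p + M
          · rw [glue3_apply_mid a w b k (by omega) hkm, glue3_apply_mid _ w b k (by omega) hkm]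
          · rw [glue3_apply_ge a w b k (by omega), glue3_apply_ge _ w b k (by omega)]
    · have hw := wt_update_add a ⟨i.val, hip⟩ (!a ⟨i.val, hip⟩)
      rw [if_pos hip, glue3_apply_lt a w b i hip]
      unfold inCharge
      rcases hai : a ⟨i.val, hip⟩ with _ | _
      · rw [hai] at hw
        simp only [Bool.not_false, Bool.false_eq_true, if_false, if_true] at hw ⊢
        omega
      · rw [hai] at hw
        simp only [Bool.not_true, Bool.false_eq_true, if_false, if_true] at hw ⊢
        omega
  · -- `i` in the suffix block
    have hiq : p + M ≤ i.val := by omega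
    have hiq' : i.val - (p + M) < q := by have := i.isLt; omega
    refine ⟨a, Function.update b ⟨i.val - (p + M), hiq'⟩ (!b ⟨i.val - (p + M), hiq'⟩),
      fun w => ?_, fun w => ?_⟩
    · funext k
      by_cases hk : k = i
      · subst hk
        rw [Function.update_self, glue3_apply_ge a w b k hiq, glue3_apply_ge a w _ k hiq,
          Function.update_self]
      · rw [Function.update_of_ne hk]
        by_cases hkp : k.val < p
        · rw [glue3_apply_lt a w b k hkp, glue3_apply_lt a w _ k hkp]
        · by_cases hkm : k.val < p + M
          · rw [glue3_apply_mid a w b k (by omega) hkm, glue3_apply_mid a w _ k (by omega) hkm]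
          · rw [glue3_apply_ge a w b k (by omega), glue3_apply_ge a w _ k (by omega),
              Function.update_of_ne]
            intro h
            apply hk
            have h' := congrArg Fin.val h
            simp only at h'
            exact Fin.ext (by omega)
    · have hw := wt_update_add b ⟨i.val - (p + M), hiq'⟩ (!b ⟨i.val - (p + M), hiq'⟩)
      rw [if_neg hip, glue3_apply_ge a w b i hiq]
      unfold inCharge
      rcases hbi : b ⟨i.val - (p + M), hiq'⟩ with _ | _
      · rw [hbi] at hw
        simp only [Bool.not_false, Bool.false_eq_true, if_false, if_true] at hw ⊢
        omega
      · rw [hbi] at hw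
        simp only [Bool.not_true, Bool.false_eq_true, if_false, if_true] at hw ⊢
        omega

end Summit.QuantumAdvantage.AdviceFreeQNC0
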